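import Mathlib
import HarnessLib
import Summits.HubbardSuperconductivity.HubbardSuperconductivity.Theorems.KLProgrammeKLRegimeTwoVolumeBlockDefectGramBounded
import Summits.HubbardSuperconductivity.HubbardSuperconductivity.Theorems.KLProgrammeKLRegimeTwoCutoffResponseStep

/-!
# Route `KLProgramme` — crux K3, the nested two-volume pass (β′): the response-form block-defect door with MAJORANT profiles
# (`Bf, B₂` any closed-form upper bounds of the weighted-step outputs — the volume-uniform statement; cell gate-hubbard-kl, seat k3c5-p2 g6)

`…TwoVolumeBlockDefectGramBounded.sum_norm_kernel_sub_copies_le_of_gramBounded` (k3c4-p1, p526393) treats the near defect `D_near` by the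
near-identity step, whose Wick self-contraction sum `Σ_{j<k} (n+1+2j)!/((n+1)! j! 2^j)·s^j·B(n+1+2j)` is factorial in `j` up to a nilpotency
index `k ≥ |Γ′|/2`: useless at the volumes of the two-volume rate (memo RATE-HOMOGENEITY-g6.md).  Here the near bracket is instead k3c4-p2's
covariance-response step `…TwoCutoffResponseStep.sum_norm_kernel_effAction_add_sub_le_of_rowSums` along the path `D_far + t•D_near` acting on
the decoupled action `W^dec`: Polchinski's equation + the mean-value bound give
`near ≤ ((n+2)(n+3)/2)·Te·B₂(n+3) + ‖2⁻¹‖ Σ_{a+b=n+1} (a+1)(b+1)·(2T·B₂(a+1)B₂(b+1) + 2T·B₂(a+1)B₂(b+1))`,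
`Te` the ENTRY sup of `D_near` (fibre-sectional, `norm_near_le_of_fibreTail`), `2T` its row/column sums, `B₂(m) = ρ₂⁻ᵐ·e·normV(κ₂, ρ₂, Nw)/(1−θ₂)`
the profile of `effAction (D_far + t•D_near) W^dec` from the decay-weighted single-scale step (Gram constant `κ₂` of the interpolated covariance,
weighted rows `≤ α′+α+m₁′+m₁` because `|(D_far + tD_near) X′Y′| ≤ |C′X′Y′| + |C^cop X′Y′|`).  The FAR bracket and everything else are k3c4-p1's
(statement and proof adapted verbatim from p526393, credited).  Sorry-free; no definition.
-/

noncomputable section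

namespace Summit.HubbardSuperconductivity.HubbardSuperconductivity.Theorems.TwoVolumeDefect

open Finset Literature.MathematicalPhysics.QuantumLattice GrassmannAlgebra Literature.Probability.LatticeModels
  Literature.Probability.LatticeModels.BattleFederbush
open scoped Nat InnerProductSpace

variable {𝕜 : Type*} [RCLike 𝕜]

-- adapted from Summits/…/KLProgrammeKLRegimeTwoVolumeBlockDefectGramBounded.lean (k3c4-p1 g7, p526393): near bracket replaced.
/-- **NESTED TWO-VOLUME CLOSENESS AT A DEEP PIN — RESPONSE FORM, MAJORANT PROFILES.**  As `sum_norm_kernel_sub_copies_le_response`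
with the two weighted-step output profiles replaced by arbitrary majorants `Bf m ≥ ρf⁻ᵐ·e·normV(κf,ρf,Nw)/(1−θw)`,
`B₂ m ≥ ρ₂⁻ᵐ·e·normV(κ₂,ρ₂,Nw)/(1−θ₂)` (so the conclusion is a SHORT expression in `Bf, B₂`, volume-uniform once they are).  As `sum_norm_kernel_sub_copies_le_of_gramBounded`, with the near bracket
bounded by the covariance-response step: inputs `Te` (entry sup of `D_near`), `T` (its far row tail), the Gram PROPERTY of the interpolated
covariances `D_far + t•D_near` (`t ∈ [0,1]`, constant `κ₂`) and one smallness `θ₂ < 1`; no `θn`, no nilpotency index.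
[folklore; BGM 2006 (2.13)–(2.14), (2.77)–(2.80), §3; Salmhofer 1998 Prop. 1 (RGE); Pedra–Salmhofer 2008 Thm 2.4] -/
theorem sum_norm_kernel_sub_copies_le_response_maj {Γ ι : Type*} [Fintype Γ] [DecidableEq Γ] [Fintype ι] [DecidableEq ι]
    {Γ' : Type} [LinearOrder Γ'] [Fintype Γ']
    (e : Γ' ≃ ι × Γ) (C : Matrix Γ Γ 𝕜) (C' Ccop Dn Df : Matrix Γ' Γ' 𝕜) (Zs : Set Γ') [DecidablePred (· ∈ Zs)]
    (hCcop : ∀ X' Y', Ccop X' Y' = if (e X').1 = (e Y').1 then C (e X').2 (e Y').2 else 0)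
    (hDf : ∀ X' Y', Df X' Y' = if X' ∈ Zs ∧ Y' ∈ Zs then C' X' Y' - Ccop X' Y' else 0)
    (hDn : ∀ X' Y', Dn X' Y' = if X' ∈ Zs ∧ Y' ∈ Zs then 0 else C' X' Y' - Ccop X' Y')
    -- (P) periodisation, (G1)/(G2) geometry, row tail
    (hP : ∀ (X' : Γ') (Y : Γ), ∑ Y'' ∈ univ.filter (fun Y'' : Γ' => (e Y'').2 = Y), C' X' Y'' = C (e X').2 Y)
    (Far : Γ' → Γ' → Prop) [∀ X' Y', Decidable (Far X' Y')]
    (hG1 : ∀ X' Y', (e X').1 ≠ (e Y').1 → ¬ (X' ∈ Zs ∧ Y' ∈ Zs) → Far X' Y')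
    (hG2 : ∀ X' Y' Y'', (e X').1 = (e Y').1 → (e Y'').2 = (e Y').2 → Y'' ≠ Y' → ¬ (X' ∈ Zs ∧ Y' ∈ Zs) → Far X' Y'')
    {T : ℝ} (hT0 : 0 < T) (hT : ∀ X', ∑ Y' ∈ univ.filter (fun Y' : Γ' => Far X' Y'), ‖C' X' Y'‖ ≤ T)
    -- the ENTRY bound of the near defect (`norm_near_le_of_fibreTail` / `norm_near_le_of_sectional`)
    {Te : ℝ} (hTe : ∀ X' Y', ‖Dn X' Y'‖ ≤ Te)
    -- antisymmetry and decay numbers of `C`, `C′`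
    (hCt : ∀ X Y, C Y X = -C X Y) (hC't : ∀ X' Y', C' Y' X' = -C' X' Y')
    {s s' : ℝ} (hs0 : 0 ≤ s) (hs'0 : 0 ≤ s') (hs : ∀ X Y, ‖C X Y‖ ≤ s) (hs' : ∀ X' Y', ‖C' X' Y'‖ ≤ s')
    {α α' : ℝ} (hαα : 0 < α' + α) (hrow : ∀ X, ∑ Y, ‖C X Y‖ ≤ α) (hrow' : ∀ X', ∑ Y', ‖C' X' Y'‖ ≤ α')
    (dc : Γ → Γ → ℝ) (hdc : IsLabelDist dc) {m₁ m₁' : ℝ} (hm0 : 0 ≤ m₁) (hm0' : 0 ≤ m₁')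
    (hm1 : ∀ X, ∑ Y, ‖C X Y‖ * dc X Y ≤ m₁) (hm1' : ∀ X', ∑ Y', ‖C' X' Y'‖ * dc (e X').2 (e Y').2 ≤ m₁')
    -- Gram PROPERTIES of the two defects
    {κf : ℝ} (hκf : 0 < κf) (hGBf : ∀ t ∈ Set.Icc (0 : ℝ) 1, IsGramBoundedR (t • Df) κf)
    {κ₂ : ℝ} (hκ₂ : 0 < κ₂) (hGB2 : ∀ t ∈ Set.Icc (0 : ℝ) 1, IsGramBoundedR (Df + t • Dn) κ₂)
    -- the pin, far from the zone in the pulled-back coarse distance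
    {Rf : ℝ} (hRf : 0 < Rf) (w : Γ') (hdR : ∀ X, X ∈ Zs → Rf ≤ dc (e X).2 (e w).2)
    -- the coarse interaction and the block embeddings
    (Fe : ι → (Γ → 𝕜) →ₗ[𝕜] (Γ' → 𝕜)) (hFe : ∀ β v X', Fe β v X' = if (e X').1 = β then v (e X').2 else 0)
    {V : GrassmannAlgebra 𝕜 Γ} (hVe : V ∈ evenOdd 𝕜 0) (hV0 : constPart 𝕜 V = 0) (hZ : IsUnit (effPartitionFn 𝕜 C V))
    -- the coarse diameter-weighted all-degree profile and the two smallness conditions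
    (Nw : ℕ → ℝ) (hNw0 : ∀ m, 0 ≤ Nw m)
    (hNw : ∀ (m' : ℕ) (j : Fin (2 * m')) (x : Γ), ∑ Y ∈ univ.filter (fun Y : Fin (2 * m') → Γ => Y j = x),
      ‖kernel 𝕜 (effAction 𝕜 C V) (2 * m') Y‖ * (1 + labelDiam dc (univ.image Y)) ≤ Nw m')
    {ρf : ℝ} (hρf : 0 < ρf) (hθw : Real.exp 1 * (α' + α + (m₁' + m₁)) * normV Γ' κf ρf Nw / κf ^ 2 < 1)
    {ρ₂ : ℝ} (hρ₂ : 0 < ρ₂) (hθ₂ : Real.exp 1 * (α' + α + (m₁' + m₁)) * normV Γ' κ₂ ρ₂ Nw / κ₂ ^ 2 < 1)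
    -- MAJORANTS of the two weighted-step outputs (any volume-uniform closed forms, e.g. via `normV_geometric_le`)
    (Bf B₂ : ℕ → ℝ)
    (hBf : ∀ m, ρf⁻¹ ^ m * (Real.exp 1 * normV Γ' κf ρf Nw) / (1 - Real.exp 1 * (α' + α + (m₁' + m₁)) * normV Γ' κf ρf Nw / κf ^ 2) ≤ Bf m)
    (hB2 : ∀ m, ρ₂⁻¹ ^ m * (Real.exp 1 * normV Γ' κ₂ ρ₂ Nw) / (1 - Real.exp 1 * (α' + α + (m₁' + m₁)) * normV Γ' κ₂ ρ₂ Nw / κ₂ ^ 2) ≤ B₂ m)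
    (n : ℕ) (p : Fin (n + 1)) :
    ∑ X ∈ univ.filter (fun X : Fin (n + 1) → Γ' => X p = w),
        ‖kernel 𝕜 (effAction 𝕜 C' (∑ β, ExteriorAlgebra.map (Fe β) V)) (n + 1) X -
          kernel 𝕜 (∑ β, ExteriorAlgebra.map (Fe β) (effAction 𝕜 C V)) (n + 1) X‖ ≤
      ((((n + 1 + 1) * (n + 1 + 2) : ℕ) : ℝ) / 2 * Te * B₂ (n + 3) +
          ‖(2 : 𝕜)⁻¹‖ * ∑ a ∈ range (n + 2), ∑ b ∈ range (n + 2),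
            (if a + b = n + 1 then (((a + 1) * (b + 1) : ℕ) : ℝ) * (2 * T * B₂ (a + 1) * B₂ (b + 1) + 2 * T * B₂ (a + 1) * B₂ (b + 1))
              else 0)) +
        ((((n + 1 + 1) * (n + 1 + 2) : ℕ) : ℝ) / 2 * ((s' + s) / Rf) * Bf (n + 3) +
          ‖(2 : 𝕜)⁻¹‖ * ∑ a ∈ range (n + 2), ∑ b ∈ range (n + 2),
            (if a + b = n + 1 then (((a + 1) * (b + 1) : ℕ) : ℝ) *
              ((α' + α) * (Bf (a + 1) / Rf) * Bf (b + 1) + (α' + α) * Bf (a + 1) * (Bf (b + 1) / Rf)) else 0)) := by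
  -- notation: the smallness and the profile bound of the weighted step
  set θw : ℝ := Real.exp 1 * (α' + α + (m₁' + m₁)) * normV Γ' κf ρf Nw / κf ^ 2 with hθw_def
  set B : ℕ → ℝ := Bf with hB_def
  have hnormV0 : 0 ≤ normV Γ' κf ρf Nw := normV_nonneg hκf.le hρf.le hNw0
  have hαw : 0 < α' + α + (m₁' + m₁) := by linarith
  have hθw0 : 0 ≤ θw := by positivity
  have hBle : ∀ m, ρf⁻¹ ^ m * (Real.exp 1 * normV Γ' κf ρf Nw) / (1 - θw) ≤ B m := fun m => by
    rw [hB_def, hθw_def]; exact hBf m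
  have hB0 : ∀ m, 0 ≤ B m := fun m => by
    have : 0 < 1 - θw := by linarith
    exact le_trans (by positivity) (hBle m)
  -- the decoupled reference
  obtain ⟨hZ', hA'⟩ := effAction_copies_sum e C Ccop hCcop Fe hFe hVe hV0 hZ (univ : Finset ι)
  have hV'e : (∑ β, ExteriorAlgebra.map (Fe β) V) ∈ evenPart 𝕜 Γ' :=
    (mem_evenPart_iff).2 (Submodule.sum_mem _ fun β _ => map_blockEmb_mem_evenOdd_zero hVe)
  have hV'0 : constPart 𝕜 (∑ β, ExteriorAlgebra.map (Fe β) V) = 0 := by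
    rw [map_sum]; exact sum_eq_zero fun β _ => by rw [constPart_map, hV0]
  set Wdec : GrassmannAlgebra 𝕜 Γ' := effAction 𝕜 Ccop (∑ β, ExteriorAlgebra.map (Fe β) V) with hWdec
  have hWe : Wdec ∈ evenPart 𝕜 Γ' := effAction_mem_evenPart Ccop hV'e hV'0
  have hW0 : constPart 𝕜 Wdec = 0 := constPart_effAction 𝕜 Ccop _ hZ'
  -- column sums from row sums
  have hcol : ∀ Y, ∑ X, ‖C X Y‖ ≤ α := fun Y => by
    have h : ∀ X, ‖C X Y‖ = ‖C Y X‖ := fun X => by rw [hCt Y X, norm_neg]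
    simp_rw [h]; exact hrow Y
  have hcol' : ∀ Y', ∑ X', ‖C' X' Y'‖ ≤ α' := fun Y' => by
    have h : ∀ X', ‖C' X' Y'‖ = ‖C' Y' X'‖ := fun X' => by rw [hC't Y' X', norm_neg]
    simp_rw [h]; exact hrow' Y'
  -- the tree weight: `1 + diam` of the pulled-back coarse pseudo-distance
  set wt : Finset Γ' → ℝ := fun S => diamWeight (fun t => (1 + (1 : ℝ) * t) ^ 1) dc (S.image fun X' => (e X').2) with hwt_def
  have hwt : IsTreeWeight wt := (isTreeWeight_polyDiamWeight hdc zero_le_one 1).comap fun X' => (e X').2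
  have hpair : ∀ X' Y' : Γ', wt {X', Y'} = 1 + dc (e X').2 (e Y').2 := fun X' Y' => by
    simp only [hwt_def, image_insert, image_singleton, diamWeight_pair hdc, one_mul, pow_one]
  have hwt_apply : ∀ S : Finset Γ', wt S = 1 + labelDiam dc (S.image fun X' => (e X').2) := fun S => by
    simp only [hwt_def, diamWeight, one_mul, pow_one]
  -- the weighted profile of the decoupled action is the coarse weighted profile
  have hNf : ∀ (m' : ℕ) (j : Fin (2 * m')) (x : Γ'),
      ∑ Y ∈ univ.filter (fun Y : Fin (2 * m') → Γ' => Y j = x), ‖kernel 𝕜 Wdec (2 * m') Y‖ * wt (univ.image Y) ≤ Nw m' := by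
    intro m' j x
    rw [hA', sum_pinned_kernel_copies_sum e Fe hFe (effAction 𝕜 C V) j x (fun Y r => ‖r‖ * wt (univ.image Y))
      (fun _ => by rw [norm_zero, zero_mul])]
    refine le_trans (le_of_eq (sum_congr rfl fun Y _ => ?_)) (hNw m' j (e x).2)
    rw [hwt_apply, Finset.image_image]
    have hcomp : ((fun X' => (e X').2) ∘ fun i => e.symm ((e x).1, Y i)) = Y := by
      funext i
      simp
    rw [hcomp]
  have hNf' : ∀ (m' : ℕ) (j : Fin (2 * m')) (x : Γ'),
      ∑ Y ∈ univ.filter (fun Y : Fin (2 * m') → Γ' => Y j = x), ‖kernel 𝕜 Wdec (2 * m') Y‖ ≤ Nw m' :=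
    fun m' j x => (sum_norm_le_sum_norm_mul_wt hwt _ _).trans (hNf m' j x)
  -- weighted rows / columns of `s • Df`
  have hDfrow : ∀ X', ∑ Y', ‖Df X' Y'‖ * (1 + dc (e X').2 (e Y').2) ≤ α' + α + (m₁' + m₁) := by
    intro X'
    have h1 : ∑ Y', ‖C' X' Y'‖ * (1 + dc (e X').2 (e Y').2) ≤ α' + m₁' := by
      have : ∑ Y', ‖C' X' Y'‖ * (1 + dc (e X').2 (e Y').2) = ∑ Y', ‖C' X' Y'‖ + ∑ Y', ‖C' X' Y'‖ * dc (e X').2 (e Y').2 := by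
        rw [← sum_add_distrib]; exact sum_congr rfl fun Y' _ => by ring
      rw [this]; exact add_le_add (hrow' X') (hm1' X')
    have h2 : ∑ Y', ‖Ccop X' Y'‖ * (1 + dc (e X').2 (e Y').2) ≤ α + m₁ := by
      rw [sum_weight_norm_copies_row e C Ccop hCcop (fun Y => 1 + dc (e X').2 Y) X']
      have : ∑ Y, ‖C (e X').2 Y‖ * (1 + dc (e X').2 Y) = ∑ Y, ‖C (e X').2 Y‖ + ∑ Y, ‖C (e X').2 Y‖ * dc (e X').2 Y := by
        rw [← sum_add_distrib]; exact sum_congr rfl fun Y _ => by ring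
      rw [this]; exact add_le_add (hrow _) (hm1 _)
    calc ∑ Y', ‖Df X' Y'‖ * (1 + dc (e X').2 (e Y').2)
        ≤ ∑ Y', (‖C' X' Y'‖ * (1 + dc (e X').2 (e Y').2) + ‖Ccop X' Y'‖ * (1 + dc (e X').2 (e Y').2)) := by
          refine sum_le_sum fun Y' _ => ?_
          rw [← add_mul]
          exact mul_le_mul_of_nonneg_right (norm_far_le_add C' Ccop Df Zs hDf X' Y') (by linarith [hdc.nonneg (e X').2 (e Y').2])
      _ = ∑ Y', ‖C' X' Y'‖ * (1 + dc (e X').2 (e Y').2) + ∑ Y', ‖Ccop X' Y'‖ * (1 + dc (e X').2 (e Y').2) := sum_add_distrib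
      _ ≤ (α' + m₁') + (α + m₁) := add_le_add h1 h2
      _ = α' + α + (m₁' + m₁) := by ring
  have hsrow : ∀ s ∈ Set.Icc (0 : ℝ) 1, ∀ X', ∑ Y', ‖(s • Df) X' Y'‖ * wt {X', Y'} ≤ α' + α + (m₁' + m₁) := by
    intro s hs X'
    refine le_trans (sum_le_sum fun Y' _ => ?_) (hDfrow X')
    rw [hpair, Matrix.smul_apply, norm_smul, Real.norm_eq_abs, abs_of_nonneg hs.1]
    have h1 : s * ‖Df X' Y'‖ ≤ ‖Df X' Y'‖ := by nlinarith [norm_nonneg (Df X' Y'), hs.2]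
    exact mul_le_mul_of_nonneg_right h1 (by linarith [hdc.nonneg (e X').2 (e Y').2])
  have hscol : ∀ s ∈ Set.Icc (0 : ℝ) 1, ∀ Y', ∑ X', ‖(s • Df) X' Y'‖ * wt {X', Y'} ≤ α' + α + (m₁' + m₁) := by
    intro s hs Y'
    have h : ∀ X', ‖(s • Df) X' Y'‖ * wt {X', Y'} = ‖(s • Df) Y' X'‖ * wt {Y', X'} := fun X' => by
      rw [Matrix.smul_apply, Matrix.smul_apply, norm_smul, norm_smul, norm_far_swap e C C' Ccop Df Zs hCcop hDf hC't hCt Y' X',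
        Finset.pair_comm]
    simp_rw [h]
    exact hsrow s hs Y'
  -- the decay-weighted single-scale step on `(s • Df, W^dec)`
  have hstep : ∀ s ∈ Set.Icc (0 : ℝ) 1, ∀ {m : ℕ}, 0 < m → ∀ (i : Fin m) (x : Γ'),
      ∑ W ∈ univ.filter (fun W : Fin m → Γ' => W i = x), wt (univ.image W) * ‖kernel 𝕜 (effAction 𝕜 (s • Df) Wdec) m W‖ ≤ B m := by
    intro s hs m hm i x
    have h := (sum_wt_norm_kernel_effAction_le_of_gramBounded (s • Df) hwt hκf (hGBf s hs)
      Wdec hWe hW0 Nw hNw0 hNf hαw (hsrow s hs) (hscol s hs) hρf hθw).2 hm i x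
    exact h.trans (by simpa only [hθw_def] using hBle m)
  -- the far distance to the pin is dominated by the weight
  have hd_le_wt : ∀ {m : ℕ} (U : Fin m → Γ') (a b : Fin m), U a = w → dc (e (U b)).2 (e w).2 ≤ wt (univ.image U) := by
    intro m U a b ha
    rw [hwt_apply, ← ha]
    have h := le_labelDiam dc (S := (univ.image U).image fun X' => (e X').2) (a := (e (U b)).2) (b := (e (U a)).2)
      (mem_image_of_mem _ (mem_image_of_mem U (mem_univ b))) (mem_image_of_mem _ (mem_image_of_mem U (mem_univ a)))
    linarith [labelDiam_nonneg dc ((univ.image U).image fun X' => (e X').2)]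
  -- the far partition functions along the path are units
  have hZs : ∀ s ∈ Set.Icc (0 : ℝ) 1, effPartitionFn 𝕜 (s • Df) Wdec ≠ 0 := fun s hs =>
    ((sum_wt_norm_kernel_effAction_le_of_gramBounded (s • Df) hwt hκf (hGBf s hs)
      Wdec hWe hW0 Nw hNw0 hNf hαw (hsrow s hs) (hscol s hs) hρf hθw).1).ne_zero
  have hZf : IsUnit (effPartitionFn 𝕜 Df Wdec) := by
    have h := hZs 1 ⟨zero_le_one, le_rfl⟩
    rw [one_smul] at h
    exact isUnit_iff_ne_zero.2 h
  -- kernel data of `𝒱_s`, `W₁`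
  have hVs0 : ∀ s ∈ Set.Icc (0 : ℝ) 1, ∀ (m : ℕ) (x : Γ'),
      ∑ U ∈ univ.filter (fun U : Fin (m + 1) → Γ' => U 0 = x), ‖kernel 𝕜 (effAction 𝕜 (s • Df) Wdec) (m + 1) U‖ ≤ B (m + 1) := by
    intro s hs m x
    refine le_trans (sum_le_sum fun U _ => ?_) (hstep s hs (Nat.succ_pos m) 0 x)
    exact le_mul_of_one_le_left (norm_nonneg _) (hwt.one_le _)
  have hVsm : ∀ s ∈ Set.Icc (0 : ℝ) 1, ∀ (m : ℕ) (i : Fin m),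
      ∑ U ∈ univ.filter (fun U : Fin (m + 1) → Γ' => U i.succ = w),
        dc (e (U 0)).2 (e w).2 * ‖kernel 𝕜 (effAction 𝕜 (s • Df) Wdec) (m + 1) U‖ ≤ B (m + 1) := by
    intro s hs m i
    refine le_trans (sum_le_sum fun U hU => ?_) (hstep s hs (Nat.succ_pos m) i.succ w)
    simp only [mem_filter, mem_univ, true_and] at hU
    exact mul_le_mul_of_nonneg_right (hd_le_wt U i.succ 0 hU) (norm_nonneg _)
  have hVsL : ∀ s ∈ Set.Icc (0 : ℝ) 1,
      ∑ Z ∈ univ.filter (fun Z : Fin (n + 1 + 1 + 1) → Γ' => Z (Fin.castSucc (Fin.castSucc p)) = w),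
        dc (e (Z (Fin.last (n + 1 + 1)))).2 (e w).2 * ‖kernel 𝕜 (effAction 𝕜 (s • Df) Wdec) (n + 1 + 2) Z‖ ≤ B (n + 3) := by
    intro s hs
    refine le_trans (sum_le_sum fun Z hZ => ?_) (hstep s hs (by omega) (Fin.castSucc (Fin.castSucc p)) w)
    simp only [mem_filter, mem_univ, true_and] at hZ
    exact mul_le_mul_of_nonneg_right (hd_le_wt Z _ _ hZ) (norm_nonneg _)
  have hNn : ∀ (m : ℕ) (j : Fin m) (x : Γ'), ∑ Z ∈ univ.filter (fun Z : Fin m → Γ' => Z j = x),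
      ‖kernel 𝕜 (effAction 𝕜 Df Wdec) m Z‖ ≤ B m := by
    intro m j x
    have h1 := hstep 1 ⟨zero_le_one, le_rfl⟩ (Fin.pos j) j x
    rw [one_smul] at h1
    refine le_trans (sum_le_sum fun Z _ => ?_) h1
    exact le_mul_of_one_le_left (norm_nonneg _) (hwt.one_le _)
  -- FAR bracket
  have hfarB := sum_norm_kernel_effAction_sub_self_le_of_far Df Wdec hW0 (mem_evenPart_iff.1 hWe) hZs
    (fun X' Y' h => far_apply_of_not C' Ccop Df Zs hDf h) (by positivity : (0 : ℝ) ≤ s' + s)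
    (fun X' Y' => norm_far_le e C C' Ccop Df Zs hCcop hDf hs'0 hs0 hs' hs X' Y') hαα.le hαα.le
    (fun X' => sum_norm_far_row_le e C C' Ccop Df Zs hCcop hDf hrow' hrow X')
    (fun Y' => sum_norm_far_col_le e C C' Ccop Df Zs hCcop hDf hcol' hcol Y')
    (fun X => dc (e X).2 (e w).2) (fun X => hdc.nonneg _ _) hRf hdR w B B B hB0 hB0 hVs0 hVsm n p hVsL
  -- NEAR bracket: the covariance-response (Polchinski) step along `Df + t • Dn` acting on `W^dec` (NO Wick sum, no nilpotency index)
  set θ₂ : ℝ := Real.exp 1 * (α' + α + (m₁' + m₁)) * normV Γ' κ₂ ρ₂ Nw / κ₂ ^ 2 with hθ₂_def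
  have hnormV2 : 0 ≤ normV Γ' κ₂ ρ₂ Nw := normV_nonneg hκ₂.le hρ₂.le hNw0
  have hθ₂0 : 0 ≤ θ₂ := by positivity
  have hB₂le : ∀ m, ρ₂⁻¹ ^ m * (Real.exp 1 * normV Γ' κ₂ ρ₂ Nw) / (1 - θ₂) ≤ B₂ m := fun m => by
    rw [hθ₂_def]; exact hB2 m
  have hB₂0 : ∀ m, 0 ≤ B₂ m := fun m => by
    have : 0 < 1 - θ₂ := by linarith
    exact le_trans (by positivity) (hB₂le m)
  -- entries of the interpolated covariance are dominated by `|C′| + |C^cop|`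
  have hPle : ∀ t ∈ Set.Icc (0 : ℝ) 1, ∀ X' Y', ‖(Df + t • Dn) X' Y'‖ ≤ ‖C' X' Y'‖ + ‖Ccop X' Y'‖ := by
    intro t ht X' Y'
    rw [Matrix.add_apply, Matrix.smul_apply, hDf, hDn]
    by_cases hz : X' ∈ Zs ∧ Y' ∈ Zs
    · rw [if_pos hz, if_pos hz, smul_zero, add_zero]; exact norm_sub_le _ _
    · rw [if_neg hz, if_neg hz, zero_add, norm_smul, Real.norm_eq_abs, abs_of_nonneg ht.1]
      exact (mul_le_of_le_one_left (norm_nonneg _) ht.2).trans (norm_sub_le _ _)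
  have hPswap : ∀ (t : ℝ) X' Y', ‖(Df + t • Dn) Y' X'‖ = ‖(Df + t • Dn) X' Y'‖ := by
    intro t X' Y'
    have hf : Df Y' X' = -Df X' Y' := by
      by_cases hz : X' ∈ Zs ∧ Y' ∈ Zs
      · rw [hDf, if_pos hz.symm, hDf, if_pos hz, hCcop, hCcop, hC't X' Y']
        by_cases hb : (e X').1 = (e Y').1
        · rw [if_pos hb.symm, if_pos hb, hCt (e X').2 (e Y').2]; ring
        · rw [if_neg (fun h => hb h.symm), if_neg hb]; ring
      · rw [hDf, if_neg (fun h => hz h.symm), hDf, if_neg hz, neg_zero]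
    have hn : Dn Y' X' = -Dn X' Y' := by
      by_cases hz : X' ∈ Zs ∧ Y' ∈ Zs
      · rw [hDn, if_pos hz.symm, hDn, if_pos hz, neg_zero]
      · rw [hDn, if_neg (fun h => hz h.symm), hDn, if_neg hz, hCcop, hCcop, hC't X' Y']
        by_cases hb : (e X').1 = (e Y').1
        · rw [if_pos hb.symm, if_pos hb, hCt (e X').2 (e Y').2]; ring
        · rw [if_neg (fun h => hb h.symm), if_neg hb]; ring
    rw [Matrix.add_apply, Matrix.smul_apply, Matrix.add_apply, Matrix.smul_apply, hf, hn, smul_neg, ← neg_add, norm_neg]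
  have hProw : ∀ t ∈ Set.Icc (0 : ℝ) 1, ∀ X', ∑ Y', ‖(Df + t • Dn) X' Y'‖ * wt {X', Y'} ≤ α' + α + (m₁' + m₁) := by
    intro t ht X'
    have h1 : ∑ Y', ‖C' X' Y'‖ * (1 + dc (e X').2 (e Y').2) ≤ α' + m₁' := by
      have : ∑ Y', ‖C' X' Y'‖ * (1 + dc (e X').2 (e Y').2) = ∑ Y', ‖C' X' Y'‖ + ∑ Y', ‖C' X' Y'‖ * dc (e X').2 (e Y').2 := by
        rw [← sum_add_distrib]; exact sum_congr rfl fun Y' _ => by ring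
      rw [this]; exact add_le_add (hrow' X') (hm1' X')
    have h2 : ∑ Y', ‖Ccop X' Y'‖ * (1 + dc (e X').2 (e Y').2) ≤ α + m₁ := by
      rw [sum_weight_norm_copies_row e C Ccop hCcop (fun Y => 1 + dc (e X').2 Y) X']
      have : ∑ Y, ‖C (e X').2 Y‖ * (1 + dc (e X').2 Y) = ∑ Y, ‖C (e X').2 Y‖ + ∑ Y, ‖C (e X').2 Y‖ * dc (e X').2 Y := by
        rw [← sum_add_distrib]; exact sum_congr rfl fun Y _ => by ring
      rw [this]; exact add_le_add (hrow _) (hm1 _)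
    calc ∑ Y', ‖(Df + t • Dn) X' Y'‖ * wt {X', Y'}
        ≤ ∑ Y', (‖C' X' Y'‖ * (1 + dc (e X').2 (e Y').2) + ‖Ccop X' Y'‖ * (1 + dc (e X').2 (e Y').2)) := by
          refine sum_le_sum fun Y' _ => ?_
          rw [hpair, ← add_mul]
          exact mul_le_mul_of_nonneg_right (hPle t ht X' Y') (by linarith [hdc.nonneg (e X').2 (e Y').2])
      _ = ∑ Y', ‖C' X' Y'‖ * (1 + dc (e X').2 (e Y').2) + ∑ Y', ‖Ccop X' Y'‖ * (1 + dc (e X').2 (e Y').2) := sum_add_distrib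
      _ ≤ (α' + m₁') + (α + m₁) := add_le_add h1 h2
      _ = α' + α + (m₁' + m₁) := by ring
  have hPcol : ∀ t ∈ Set.Icc (0 : ℝ) 1, ∀ Y', ∑ X', ‖(Df + t • Dn) X' Y'‖ * wt {X', Y'} ≤ α' + α + (m₁' + m₁) := by
    intro t ht Y'
    have h : ∀ X', ‖(Df + t • Dn) X' Y'‖ * wt {X', Y'} = ‖(Df + t • Dn) Y' X'‖ * wt {Y', X'} := fun X' => by
      rw [hPswap t Y' X', Finset.pair_comm]
    simp_rw [h]
    exact hProw t ht Y'
  -- the decay-weighted single-scale step on `(Df + t • Dn, W^dec)`, uniformly on the path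
  have hstep2 : ∀ t ∈ Set.Icc (0 : ℝ) 1, IsUnit (effPartitionFn 𝕜 (Df + t • Dn) Wdec) ∧ ∀ {m : ℕ}, 0 < m → ∀ (i : Fin m) (x : Γ'),
      ∑ W ∈ univ.filter (fun W : Fin m → Γ' => W i = x), wt (univ.image W) * ‖kernel 𝕜 (effAction 𝕜 (Df + t • Dn) Wdec) m W‖ ≤ B₂ m := by
    intro t ht
    have h := sum_wt_norm_kernel_effAction_le_of_gramBounded (Df + t • Dn) hwt hκ₂ (hGB2 t ht)
      Wdec hWe hW0 Nw hNw0 hNf hαw (hProw t ht) (hPcol t ht) hρ₂ hθ₂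
    refine ⟨h.1, @fun m hm i x => ?_⟩
    exact (h.2 hm i x).trans (by simpa only [hθ₂_def] using hB₂le m)
  have hZ2 : ∀ t ∈ Set.Icc (0 : ℝ) 1, effPartitionFn 𝕜 (Df + (t : ℝ) • Dn) Wdec ≠ 0 := fun t ht => (hstep2 t ht).1.ne_zero
  have hV20 : ∀ t ∈ Set.Icc (0 : ℝ) 1, ∀ (m : ℕ) (x : Γ'),
      ∑ U ∈ univ.filter (fun U : Fin (m + 1) → Γ' => U 0 = x), ‖kernel 𝕜 (effAction 𝕜 (Df + (t : ℝ) • Dn) Wdec) (m + 1) U‖ ≤ B₂ (m + 1) := by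
    intro t ht m x
    refine le_trans (sum_le_sum fun U _ => ?_) ((hstep2 t ht).2 (Nat.succ_pos m) 0 x)
    exact le_mul_of_one_le_left (norm_nonneg _) (hwt.one_le _)
  have hV2t : ∀ t ∈ Set.Icc (0 : ℝ) 1, ∀ (m : ℕ) (i : Fin m),
      ∑ U ∈ univ.filter (fun U : Fin (m + 1) → Γ' => U i.succ = w), ‖kernel 𝕜 (effAction 𝕜 (Df + (t : ℝ) • Dn) Wdec) (m + 1) U‖ ≤ B₂ (m + 1) := by
    intro t ht m i
    refine le_trans (sum_le_sum fun U _ => ?_) ((hstep2 t ht).2 (Nat.succ_pos m) i.succ w)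
    exact le_mul_of_one_le_left (norm_nonneg _) (hwt.one_le _)
  have hV2L : ∀ t ∈ Set.Icc (0 : ℝ) 1,
      ∑ Z ∈ univ.filter (fun Z : Fin (n + 1 + 1 + 1) → Γ' => Z (Fin.castSucc (Fin.castSucc p)) = w),
        ‖kernel 𝕜 (effAction 𝕜 (Df + (t : ℝ) • Dn) Wdec) (n + 1 + 2) Z‖ ≤ B₂ (n + 3) := by
    intro t ht
    refine le_trans (sum_le_sum fun Z _ => ?_) ((hstep2 t ht).2 (by omega) (Fin.castSucc (Fin.castSucc p)) w)
    exact le_mul_of_one_le_left (norm_nonneg _) (hwt.one_le _)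
  have hT2 : (0 : ℝ) ≤ 2 * T := by positivity
  have hnear2 := sum_norm_kernel_effAction_add_sub_le_of_rowSums Df Dn Wdec hW0 (mem_evenPart_iff.1 hWe) hZ2 hTe hT2 hT2
    (fun X' => sum_norm_near_row_le e C C' Ccop Dn Zs hCcop hDn hP Far hG1 hG2 hT X')
    (fun Y' => sum_norm_near_col_le e C C' Ccop Dn Zs hCcop hDn hP hC't hCt Far hG1 hG2 hT Y') w B₂ B₂ B₂ hB₂0 hB₂0 hV20 hV2t n p hV2L
  -- in the split lemma's shape: `effAction (Df + Dn) W^dec = effAction Dn (effAction Df W^dec)`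
  have hnearB : ∑ X ∈ univ.filter (fun X : Fin (n + 1) → Γ' => X p = w),
      ‖kernel 𝕜 (effAction 𝕜 Dn (effAction 𝕜 Df Wdec)) (n + 1) X - kernel 𝕜 (effAction 𝕜 Df Wdec) (n + 1) X‖ ≤
        (((n + 1 + 1) * (n + 1 + 2) : ℕ) : ℝ) / 2 * Te * B₂ (n + 3) +
          ‖(2 : 𝕜)⁻¹‖ * ∑ a ∈ range (n + 2), ∑ b ∈ range (n + 2),
            (if a + b = n + 1 then (((a + 1) * (b + 1) : ℕ) : ℝ) * (2 * T * B₂ (a + 1) * B₂ (b + 1) + 2 * T * B₂ (a + 1) * B₂ (b + 1))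
              else 0) := by
    rw [← effAction_add 𝕜 Dn Df Wdec hZf, add_comm Dn Df]
    exact hnear2
  have hdec : C' = Ccop + Dn + Df := (copies_add_near_add_far C' Ccop Dn Df Zs hDf hDn).symm
  rw [hdec, ← hA']
  exact sum_norm_kernel_effAction_defect_le_of_split 𝕜 Ccop Dn Df _ hZ' hZf _ hnearB hfarB

end Summit.HubbardSuperconductivity.HubbardSuperconductivity.Theorems.TwoVolumeDefect

end
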